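import Summits.QuantumFields.QCD.Theorems.QuarksAsStableActionCriticalLineDiamagnetismCellSecondOrderAux1

/-!
# B6 cell sub-stub `cellSecondOrder`, Aux 2: site blocks of the walk expansion — recursion, locality, decay
(crux `stmt-QuantumFields-9734`, decl `Summit.QuantumFields.QCD.Theses.QuarksAsStableAction.CriticalLineDiamagnetism`,
line `Sketch`, Route B step B6; sub-problem context `Summits/QuantumFields/QCD/Statement.lean`)

The `4 × 4` site blocks `W_j(u, v) = torusWalk L M s₀ s₁ j u v` of `x^j (1 ⊗ N⁻¹)` satisfy the nearest-neighbour walk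
recursion `W_{j+1}(u,v) = N⁻¹ Σ_μ [σ_μ(u) P₋^μ W_j(u+e_μ,v) + σ_μ(u−e_μ) P₊^μ W_j(u−e_μ,v)]` (`torusWalk_succ`), hence vanish
for `j < tdist(u − v)` (`torusWalk_eq_zero_of_lt`); consequently the free propagator blocks `freeBlock = (sFree⁻¹)(u,v)` are
the truncated walk sums up to a tail `≤ q^d (1−q)⁻¹/M` and decay like `q^{tdist(u−v)}`, `q = 2/M` (registered:
`cellWalkDecay`).  Blocks never increase the `ℓ²` operator norm (`l2_opNorm_block_le`).
-/

noncomputable section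

open scoped BigOperators Matrix Kronecker ComplexConjugate Matrix.Norms.L2Operator
open Matrix Literature.MathematicalPhysics.QuantumLattice
open Summit.QuantumFields.QCD.Cruxes.CriticalLineDiamagnetism.ChessboardCellGain.CellKappa

namespace Summit.QuantumFields.QCD.Cruxes.CriticalLineDiamagnetism.ChessboardCellGain.CellWalk

/-! ### Blocks do not increase the operator norm -/

/-- Row-selection matrices along an injective map are co-isometries: `E Eᴴ = 1`. -/
theorem rowSelect_mul_conjTranspose {m k : Type} [Fintype m] [DecidableEq m] [Fintype k] [DecidableEq k]
    (f : k → m) (hf : Function.Injective f) :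
    (Matrix.of fun (i : k) (p : m) => if p = f i then (1 : ℂ) else 0) *
      (Matrix.of fun (i : k) (p : m) => if p = f i then (1 : ℂ) else 0)ᴴ = 1 := by
  ext s t
  simp only [Matrix.mul_apply, Matrix.conjTranspose_apply, Matrix.of_apply, Matrix.one_apply]
  rw [Finset.sum_eq_single (f t)]
  · by_cases hst : s = t
    · subst hst; simp
    · simp [hst, (hf.ne hst).symm]
  · intro j _ hj; simp [hj]
  · intro hh; exact absurd (Finset.mem_univ _) hh

/-- Row-selection matrices have norm at most one (both `E` and `Eᴴ`). -/
theorem l2_opNorm_rowSelect_le {m k : Type} [Fintype m] [DecidableEq m] [Fintype k] [DecidableEq k]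
    (f : k → m) (hf : Function.Injective f) :
    ‖(Matrix.of fun (i : k) (p : m) => if p = f i then (1 : ℂ) else 0)‖ ≤ 1 ∧
      ‖(Matrix.of fun (i : k) (p : m) => if p = f i then (1 : ℂ) else 0)ᴴ‖ ≤ 1 := by
  have hone : ‖(1 : Matrix k k ℂ)‖ ≤ 1 := by
    rw [Matrix.cstar_norm_def, map_one]; exact ContinuousLinearMap.norm_id_le
  have hh := Matrix.l2_opNorm_conjTranspose_mul_self
    (Matrix.of fun (i : k) (p : m) => if p = f i then (1 : ℂ) else 0)ᴴ
  rw [Matrix.conjTranspose_conjTranspose, rowSelect_mul_conjTranspose f hf] at hh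
  have hH : ‖(Matrix.of fun (i : k) (p : m) => if p = f i then (1 : ℂ) else 0)ᴴ‖ ≤ 1 := by
    nlinarith [norm_nonneg (Matrix.of fun (i : k) (p : m) => if p = f i then (1 : ℂ) else 0)ᴴ]
  exact ⟨by rw [← Matrix.l2_opNorm_conjTranspose]; exact hH, hH⟩

/-- **Blocks along injective row/column selections do not increase the `ℓ²` operator norm.** -/
theorem l2_opNorm_submatrix_le_of_injective {m k : Type} [Fintype m] [DecidableEq m] [Fintype k] [DecidableEq k]
    (A : Matrix m m ℂ) (f g : k → m) (hf : Function.Injective f) (hg : Function.Injective g) :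
    ‖A.submatrix f g‖ ≤ ‖A‖ := by
  set P : Matrix k m ℂ := Matrix.of fun i p => if p = f i then (1 : ℂ) else 0 with hP
  set Q : Matrix k m ℂ := Matrix.of fun i p => if p = g i then (1 : ℂ) else 0 with hQ
  have hPA : A.submatrix f g = P * A * Qᴴ := by
    ext s t
    simp only [hP, hQ, Matrix.submatrix_apply, Matrix.mul_apply, Matrix.conjTranspose_apply, Matrix.of_apply]
    rw [Finset.sum_eq_single (g t)]
    · rw [Finset.sum_eq_single (f s)]
      · simp
      · intro i _ hi; simp [hi]
      · intro hh; exact absurd (Finset.mem_univ _) hh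
    · intro j _ hj; simp [hj]
    · intro hh; exact absurd (Finset.mem_univ _) hh
  rw [hPA]
  calc ‖P * A * Qᴴ‖ ≤ ‖P * A‖ * ‖Qᴴ‖ := Matrix.l2_opNorm_mul _ _
    _ ≤ (‖P‖ * ‖A‖) * ‖Qᴴ‖ := by gcongr; exact Matrix.l2_opNorm_mul _ _
    _ ≤ (1 * ‖A‖) * 1 := by gcongr; exacts [(l2_opNorm_rowSelect_le f hf).1, (l2_opNorm_rowSelect_le g hg).2]
    _ = ‖A‖ := by ring

/-- The `4 × 4` site block `(u, v)` of a spin-site matrix has norm at most that of the matrix. -/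
theorem l2_opNorm_block_le {S : Type} [Fintype S] [DecidableEq S] (A : Matrix (S × Fin 4) (S × Fin 4) ℂ) (u v : S) :
    ‖(Matrix.of fun i k : Fin 4 => A (u, i) (v, k))‖ ≤ ‖A‖ := by
  have : (Matrix.of fun i k : Fin 4 => A (u, i) (v, k)) = A.submatrix (fun i => (u, i)) (fun k => (v, k)) := by
    ext i k; rfl
  rw [this]
  exact l2_opNorm_submatrix_le_of_injective A _ _ (fun i k hik => by simpa using hik) (fun i k hik => by simpa using hik)

/-! ### Site blocks: algebra -/

section Blocks

variable {S : Type}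

/-- Blocks of a product. -/
theorem block_mul [Fintype S] (A B : Matrix (S × Fin 4) (S × Fin 4) ℂ) (u v : S) :
    (Matrix.of fun i k : Fin 4 => (A * B) (u, i) (v, k)) =
      ∑ w : S, (Matrix.of fun i k : Fin 4 => A (u, i) (w, k)) * (Matrix.of fun i k : Fin 4 => B (w, i) (v, k)) := by
  ext i k
  simp only [Matrix.of_apply, Matrix.mul_apply, Fintype.sum_prod_type, Matrix.sum_apply]

/-- Blocks of a Kronecker product with a site matrix. -/
theorem block_kronecker (C : Matrix S S ℂ) (D : Matrix (Fin 4) (Fin 4) ℂ) (u v : S) :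
    (Matrix.of fun i k : Fin 4 => (C ⊗ₖ D) (u, i) (v, k)) = C u v • D := by
  ext i k
  simp [Matrix.kroneckerMap_apply]

/-- Blocks of a sum. -/
theorem block_add (A B : Matrix (S × Fin 4) (S × Fin 4) ℂ) (u v : S) :
    (Matrix.of fun i k : Fin 4 => (A + B) (u, i) (v, k)) =
      (Matrix.of fun i k : Fin 4 => A (u, i) (v, k)) + (Matrix.of fun i k : Fin 4 => B (u, i) (v, k)) := by
  ext i k; rfl

/-- Blocks of a finite sum. -/
theorem block_sum {ι : Type} (T : Finset ι) (A : ι → Matrix (S × Fin 4) (S × Fin 4) ℂ) (u v : S) :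
    (Matrix.of fun i k : Fin 4 => (∑ t ∈ T, A t) (u, i) (v, k)) =
      ∑ t ∈ T, (Matrix.of fun i k : Fin 4 => A t (u, i) (v, k)) := by
  ext i k
  simp only [Matrix.of_apply, Matrix.sum_apply]

end Blocks

/-! ### The walk recursion -/

variable {L : ℕ} [NeZero L]

omit [NeZero L] in
/-- The site blocks of a one-direction hop. -/
theorem block_dirHop (e : ZMod L × ZMod L) (s : ZMod L × ZMod L → ℂ) (μ : Fin 4) (u w : ZMod L × ZMod L) :
    (Matrix.of fun i k : Fin 4 => dirHop L e s μ (u, i) (w, k)) =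
      (if w = u + e then s u else 0) • pMinus μ + (if u = w + e then s w else 0) • pPlus μ := by
  rw [dirHop, block_add, block_kronecker, block_kronecker, Matrix.of_apply, Matrix.of_apply]

/-- The site blocks of `x = (1 ⊗ N⁻¹) h`. -/
theorem block_xHop (M s₀ s₁ : ℝ) (u w : ZMod L × ZMod L) :
    (Matrix.of fun i k : Fin 4 => xHop L M s₀ s₁ (u, i) (w, k)) =
      nInv M s₀ s₁ * ((if w = u + (1, 0) then seam u.1 else 0) • pMinus 2 + (if u = w + (1, 0) then seam w.1 else 0) • pPlus 2 +
        ((if w = u + (0, 1) then seam u.2 else 0) • pMinus 3 + (if u = w + (0, 1) then seam w.2 else 0) • pPlus 3)) := by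
  rw [xHop, block_mul]
  have : ∀ w' : ZMod L × ZMod L,
      (Matrix.of fun i k : Fin 4 => ((1 : Matrix (ZMod L × ZMod L) (ZMod L × ZMod L) ℂ) ⊗ₖ CellKappa.nInv M s₀ s₁) (u, i) (w', k)) *
        (Matrix.of fun i k : Fin 4 => sHopTot L (w', i) (w, k)) =
      if u = w' then nInv M s₀ s₁ * (Matrix.of fun i k : Fin 4 => sHopTot L (w', i) (w, k)) else 0 := by
    intro w'
    rw [block_kronecker, Matrix.one_apply]
    split_ifs <;> simp
  simp_rw [this]
  rw [Finset.sum_ite_eq, if_pos (Finset.mem_univ _), sHopTot, block_add, block_dirHop, block_dirHop]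

/-- **The walk recursion, operator form**: the `(u, v)` block of `x Y` collects the four neighbouring blocks of `Y`. -/
theorem block_xHop_mul (M s₀ s₁ : ℝ) (Y : Matrix ((ZMod L × ZMod L) × Fin 4) ((ZMod L × ZMod L) × Fin 4) ℂ)
    (u v : ZMod L × ZMod L) :
    (Matrix.of fun i k : Fin 4 => (xHop L M s₀ s₁ * Y) (u, i) (v, k)) =
      nInv M s₀ s₁ *
        (seam u.1 • (pMinus 2 * Matrix.of fun i k : Fin 4 => Y (u + (1, 0), i) (v, k)) +
          seam (u - (1, 0)).1 • (pPlus 2 * Matrix.of fun i k : Fin 4 => Y (u - (1, 0), i) (v, k)) +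
          seam u.2 • (pMinus 3 * Matrix.of fun i k : Fin 4 => Y (u + (0, 1), i) (v, k)) +
          seam (u - (0, 1)).2 • (pPlus 3 * Matrix.of fun i k : Fin 4 => Y (u - (0, 1), i) (v, k))) := by
  rw [block_mul]
  simp_rw [block_xHop, Matrix.mul_assoc, ← Finset.mul_sum, Matrix.add_mul, Finset.sum_add_distrib, ite_smul, zero_smul,
    ite_mul, zero_mul, smul_mul_assoc]
  have hb : ∀ (e : ZMod L × ZMod L) (f : ZMod L × ZMod L → Matrix (Fin 4) (Fin 4) ℂ),
      (∑ w : ZMod L × ZMod L, if u = w + e then f w else 0) = f (u - e) := by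
    intro e f
    have : ∀ w, (if u = w + e then f w else 0) = if w = u - e then f w else 0 := by
      intro w
      by_cases hw : w = u - e
      · rw [if_pos hw, if_pos (by rw [hw, sub_add_cancel])]
      · rw [if_neg hw, if_neg (fun h' => hw (by rw [h', add_sub_cancel_right]))]
    simp_rw [this]
    rw [Finset.sum_ite_eq' Finset.univ, if_pos (Finset.mem_univ _)]
  rw [Finset.sum_ite_eq' Finset.univ, if_pos (Finset.mem_univ _), Finset.sum_ite_eq' Finset.univ,
    if_pos (Finset.mem_univ _), hb, hb]
  simp only [add_assoc]

/-- Base of the recursion: `W_0(u, v) = [u = v] N⁻¹`. -/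
theorem torusWalk_zero (M s₀ s₁ : ℝ) (u v : ZMod L × ZMod L) :
    torusWalk L M s₀ s₁ 0 u v = if u = v then nInv M s₀ s₁ else 0 := by
  rw [torusWalk, pow_zero, Matrix.one_mul]
  change (Matrix.of fun i k : Fin 4 => ((1 : Matrix (ZMod L × ZMod L) (ZMod L × ZMod L) ℂ) ⊗ₖ
    CellKappa.nInv M s₀ s₁) (u, i) (v, k)) = _
  rw [block_kronecker, Matrix.one_apply]
  split_ifs <;> simp

/-- **The walk recursion**: `W_{j+1}(u,v) = N⁻¹ Σ_μ [σ_μ(u) P₋^μ W_j(u+e_μ,v) + σ_μ(u−e_μ) P₊^μ W_j(u−e_μ,v)]`. -/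
theorem torusWalk_succ (M s₀ s₁ : ℝ) (j : ℕ) (u v : ZMod L × ZMod L) :
    torusWalk L M s₀ s₁ (j + 1) u v =
      nInv M s₀ s₁ *
        (seam u.1 • (pMinus 2 * torusWalk L M s₀ s₁ j (u + (1, 0)) v) +
          seam (u - (1, 0)).1 • (pPlus 2 * torusWalk L M s₀ s₁ j (u - (1, 0)) v) +
          seam u.2 • (pMinus 3 * torusWalk L M s₀ s₁ j (u + (0, 1)) v) +
          seam (u - (0, 1)).2 • (pPlus 3 * torusWalk L M s₀ s₁ j (u - (0, 1)) v)) := by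
  simp only [torusWalk]
  rw [pow_succ', Matrix.mul_assoc]
  exact block_xHop_mul M s₀ s₁ _ u v

/-! ### Locality -/

/-- A unit step increases the torus distance by at most one. -/
theorem tdist_add_le (w e : ZMod L × ZMod L) (he : e = (1, 0) ∨ e = (0, 1)) : tdist (w + e) ≤ tdist w + 1 := by
  rcases he with rfl | rfl
  · simp only [tdist, Prod.fst_add, Prod.snd_add, add_zero]
    have := natAbs_valMinAbs_add_one_le w.1
    omega
  · simp only [tdist, Prod.fst_add, Prod.snd_add, add_zero]
    have := natAbs_valMinAbs_add_one_le w.2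
    omega

/-- A unit step backwards increases the torus distance by at most one. -/
theorem tdist_sub_le (w e : ZMod L × ZMod L) (he : e = (1, 0) ∨ e = (0, 1)) : tdist (w - e) ≤ tdist w + 1 := by
  rcases he with rfl | rfl
  · simp only [tdist, Prod.fst_sub, Prod.snd_sub, sub_zero]
    have := natAbs_valMinAbs_sub_one_le w.1
    omega
  · simp only [tdist, Prod.fst_sub, Prod.snd_sub, sub_zero]
    have := natAbs_valMinAbs_sub_one_le w.2
    omega

omit [NeZero L] in
/-- `tdist 0 = 0`. -/
theorem tdist_zero : tdist (0 : ZMod L × ZMod L) = 0 := by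
  simp [tdist]

/-- **Locality of the walk expansion**: `W_j(u, v) = 0` whenever `j < tdist(u − v)`. -/
theorem torusWalk_eq_zero_of_lt (M s₀ s₁ : ℝ) :
    ∀ (j : ℕ) (u v : ZMod L × ZMod L), j < tdist (u - v) → torusWalk L M s₀ s₁ j u v = 0 := by
  intro j
  induction j with
  | zero =>
    intro u v h
    rw [torusWalk_zero, if_neg]
    rintro rfl
    rw [sub_self, tdist_zero] at h
    exact Nat.lt_irrefl 0 h
  | succ j ih =>
    intro u v h
    have h1 : j < tdist (u + (1, 0) - v) := by
      have := tdist_sub_le (u + (1, 0) - v) (1, 0) (Or.inl rfl)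
      rw [show u + (1, 0) - v - (1, 0) = u - v by abel] at this; omega
    have h2 : j < tdist (u - (1, 0) - v) := by
      have := tdist_add_le (u - (1, 0) - v) (1, 0) (Or.inl rfl)
      rw [show u - (1, 0) - v + (1, 0) = u - v by abel] at this; omega
    have h3 : j < tdist (u + (0, 1) - v) := by
      have := tdist_sub_le (u + (0, 1) - v) (0, 1) (Or.inr rfl)
      rw [show u + (0, 1) - v - (0, 1) = u - v by abel] at this; omega
    have h4 : j < tdist (u - (0, 1) - v) := by
      have := tdist_add_le (u - (0, 1) - v) (0, 1) (Or.inr rfl)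
      rw [show u - (0, 1) - v + (0, 1) = u - v by abel] at this; omega
    rw [torusWalk_succ, ih _ _ h1, ih _ _ h2, ih _ _ h3, ih _ _ h4]
    simp

/-! ### Blocks of the inverse: truncation and decay -/

/-- `G(u, v) = Σ_{j<d} W_j(u, v) + (block of the Neumann tail)`. -/
theorem freeBlock_eq (M s₀ s₁ : ℝ) (h : M ^ 2 + s₀ ^ 2 + s₁ ^ 2 ≠ 0) (hx : ‖xHop L M s₀ s₁‖ < 1) (d : ℕ)
    (u v : ZMod L × ZMod L) :
    freeBlock L M s₀ s₁ u v = (∑ j ∈ Finset.range d, torusWalk L M s₀ s₁ j u v) +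
        Matrix.of fun i k : Fin 4 => (xHop L M s₀ s₁ ^ d * ((∑' j : ℕ, xHop L M s₀ s₁ ^ j) *
          ((1 : Matrix (ZMod L × ZMod L) (ZMod L × ZMod L) ℂ) ⊗ₖ CellKappa.nInv M s₀ s₁))) (u, i) (v, k) := by
  rw [freeBlock, sFree_inv_eq M s₀ s₁ h hx d, block_add, block_sum]
  rfl

/-- The tail block: `‖G(u, v) − Σ_{j<d} W_j(u, v)‖ ≤ q^d (1 − q)⁻¹ / M` for `‖x‖ ≤ q < 1`. -/
theorem norm_freeBlock_sub_le (M s₀ s₁ : ℝ) (hM : 0 < M) {q : ℝ} (hxq : ‖xHop L M s₀ s₁‖ ≤ q) (hq : q < 1) (d : ℕ)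
    (u v : ZMod L × ZMod L) :
    ‖freeBlock L M s₀ s₁ u v - ∑ j ∈ Finset.range d, torusWalk L M s₀ s₁ j u v‖ ≤ q ^ d * (1 - q)⁻¹ * (1 / M) := by
  have h : M ^ 2 + s₀ ^ 2 + s₁ ^ 2 ≠ 0 := by positivity
  rw [freeBlock_eq M s₀ s₁ h (hxq.trans_lt hq) d u v, add_sub_cancel_left]
  exact (l2_opNorm_block_le _ u v).trans (l2_opNorm_tail_le M s₀ s₁ hM hxq hq d)

/-- **Decay of the free propagator blocks**: `‖G(u, v)‖ ≤ q^{tdist(u − v)} (1 − q)⁻¹ / M`. -/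
theorem norm_freeBlock_le (M s₀ s₁ : ℝ) (hM : 0 < M) {q : ℝ} (hxq : ‖xHop L M s₀ s₁‖ ≤ q) (hq : q < 1)
    (u v : ZMod L × ZMod L) :
    ‖freeBlock L M s₀ s₁ u v‖ ≤ q ^ tdist (u - v) * (1 - q)⁻¹ * (1 / M) := by
  have := norm_freeBlock_sub_le M s₀ s₁ hM hxq hq (tdist (u - v)) u v
  rwa [Finset.sum_eq_zero (fun j hj => torusWalk_eq_zero_of_lt M s₀ s₁ j u v (Finset.mem_range.1 hj)), sub_zero] at this

/-! ### Registered summary -/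

/-- **Aux theorem `cellWalkDecay`** (registered helper of `cellSecondOrder`): for `M > 2`, with `q = 2/M`, the free
spin-site propagator blocks decay like `q^{tdist}` and are the truncated walk sums up to a tail `q^d (1 − q)⁻¹ / M`. -/
theorem cellWalkDecay : ∀ (L : ℕ) [NeZero L] (M s₀ s₁ : ℝ), 2 < M → ∀ (u v : ZMod L × ZMod L), ‖freeBlock L M s₀ s₁ u v‖ ≤ (2 / M) ^ tdist (u - v) * (1 - 2 / M)⁻¹ * (1 / M) ∧ ∀ d : ℕ, ‖freeBlock L M s₀ s₁ u v - ∑ j ∈ Finset.range d, torusWalk L M s₀ s₁ j u v‖ ≤ (2 / M) ^ d * (1 - 2 / M)⁻¹ * (1 / M) := by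
  intro L _ M s₀ s₁ hM u v
  have hM0 : 0 < M := by linarith
  have hxq := l2_opNorm_xHop_le (L := L) M s₀ s₁ hM0
  have hq : 2 / M < 1 := (div_lt_one hM0).2 hM
  exact ⟨norm_freeBlock_le M s₀ s₁ hM0 hxq hq u v, fun d => norm_freeBlock_sub_le M s₀ s₁ hM0 hxq hq d u v⟩

end Summit.QuantumFields.QCD.Cruxes.CriticalLineDiamagnetism.ChessboardCellGain.CellWalk

end
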